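import Summits.NavierStokesRegularity.FunctionalMining.SpectralMixtureCandidates
import Summits.NavierStokesRegularity.FunctionalMining.TopEigHeatStable
import Summits.NavierStokesRegularity.FunctionalMining.CodomainNPRpow
import Summits.NavierStokesRegularity.FunctionalMining.StrainMomentSaturatingLaw
import HarnessLib

/-!
# The admissible mixture density `G(A) = ((a·λ⁺(A))^q + (b‖A‖)^q)^{1/q}` (part 1 of 3 of the heat side
# of K1-Q6 escape (a))

NS FUNCTIONAL MINING — search for candidate a priori estimates; no regularity claim.

For real `q ≥ 1` and `a, b ≥ 0` with `a^q + b^q = 1`, the density `mixDensity q a b` on `ℝ^{3×3}`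
(`λ⁺ = max (lam A) 0` the positive part of the top eigenvalue functional of `TopEigHeatStable`,
`‖A‖` the Frobenius norm) is convex (`convexOn_mixDensity`), `1`-Lipschitz
(`lipschitzWith_mixDensity`, two-term Minkowski `qMean_add_le`), satisfies `‖S‖/6 ≤ G(S) ≤ ‖S‖` on
strains of smooth divergence-free fields (`norm_le_six_mul_mixDensity`, `mixDensity_le_norm`), and
`∫ G(S)^q = a^q Φ_q + b^q Z_q` (`integral_mixDensity_rpow`); also `Φ_q ≤ Z_q`
(`torusTopEigMoment_le_torusStrainMoment`). These are exactly the hypotheses `hconv`/`hlip`/`hG0`/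
`hleG`/`hGle`/`hΦG` of the TREE rate bound `TopEig.hasDerivWithinAt_le_of_heatCoercive_admissible`
for the normalised spectral mixture `αΦ_q + βZ_q`. Field/matrix inequalities only; nothing about
Navier–Stokes regularity or blow-up. Census-2 (cell `pub-nsfunc`), kernel-checked; STAGED.
[ours, bookkeeping; K1-Q6 (a), heat side, part 1/3]
FILING (prove seat g25, REQUEST #17 part 1/3): census-2's `lean/mixlaw/v2/split/TopEigMixDensity.lean` 4336227f6077585d, declarations byte-identical; two one-line docstrings (`qMean_nonneg`, `mixDensity_nonneg`) and this line added for the gate's lints.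
-/

open MeasureTheory Set Filter Topology Finset
open scoped InnerProductSpace RealInnerProductSpace ContDiff

namespace Summit.NavierStokesRegularity.FunctionalMining

open Literature.Analysis.FunctionSpaces Literature.Analysis.FunctionSpaces.Torus
  Literature.Analysis.FluidPDE

namespace TopEig

open StrainL4 StrainMoment

/-! ## 1. The two-term `q`-mean `(x^q + y^q)^{1/q}` -/

/-- `qMean q x y = (x^q + y^q)^{1/q}`. [ours, bookkeeping] -/
noncomputable def qMean (q x y : ℝ) : ℝ := (x ^ q + y ^ q) ^ (1 / q)

/-- `qMean q x y ≥ 0` for `x, y ≥ 0`. [ours, bookkeeping; docstring added at filing] -/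
theorem qMean_nonneg (q : ℝ) {x y : ℝ} (hx : 0 ≤ x) (hy : 0 ≤ y) : 0 ≤ qMean q x y :=
  Real.rpow_nonneg (add_nonneg (Real.rpow_nonneg hx q) (Real.rpow_nonneg hy q)) _

/-- `(qMean q x y)^q = x^q + y^q`. [ours] -/
theorem qMean_rpow {q : ℝ} (hq : 0 < q) {x y : ℝ} (hx : 0 ≤ x) (hy : 0 ≤ y) :
    qMean q x y ^ q = x ^ q + y ^ q := by
  unfold qMean
  rw [one_div, Real.rpow_inv_rpow (add_nonneg (Real.rpow_nonneg hx q) (Real.rpow_nonneg hy q)) hq.ne']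

/-- **Two-term Minkowski**: `qMean q (a+c) (b+e) ≤ qMean q a b + qMean q c e` (`q ≥ 1`, all `≥ 0`).
[folklore: `Real.Lp_add_le_of_nonneg` on `Fin 2`] -/
theorem qMean_add_le {q : ℝ} (hq : 1 ≤ q) {a b c e : ℝ} (ha : 0 ≤ a) (hb : 0 ≤ b) (hc : 0 ≤ c)
    (he : 0 ≤ e) : qMean q (a + c) (b + e) ≤ qMean q a b + qMean q c e := by
  have h := Real.Lp_add_le_of_nonneg (s := (Finset.univ : Finset (Fin 2))) (f := ![a, b])
    (g := ![c, e]) hq (by intro i _; fin_cases i <;> simp [ha, hb])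
    (by intro i _; fin_cases i <;> simp [hc, he])
  simpa [qMean, Fin.sum_univ_two] using h

/-- `qMean` is monotone in both (nonnegative) arguments (`q > 0`). [ours] -/
theorem qMean_mono {q : ℝ} (hq : 0 < q) {x x' y y' : ℝ} (hx : 0 ≤ x) (hxx : x ≤ x') (hy : 0 ≤ y)
    (hyy : y ≤ y') : qMean q x y ≤ qMean q x' y' := by
  unfold qMean
  exact Real.rpow_le_rpow (add_nonneg (Real.rpow_nonneg hx q) (Real.rpow_nonneg hy q))
    (add_le_add (Real.rpow_le_rpow hx hxx hq.le) (Real.rpow_le_rpow hy hyy hq.le))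
    (one_div_nonneg.2 hq.le)

/-- `qMean` is positively homogeneous: `qMean q (θx) (θy) = θ qMean q x y`. [ours] -/
theorem qMean_mul {q : ℝ} (hq : 0 < q) {θ x y : ℝ} (hθ : 0 ≤ θ) (hx : 0 ≤ x) (hy : 0 ≤ y) :
    qMean q (θ * x) (θ * y) = θ * qMean q x y := by
  unfold qMean
  rw [Real.mul_rpow hθ hx, Real.mul_rpow hθ hy, ← mul_add,
    Real.mul_rpow (Real.rpow_nonneg hθ q) (add_nonneg (Real.rpow_nonneg hx q) (Real.rpow_nonneg hy q)),
    one_div, Real.rpow_rpow_inv hθ hq.ne']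

/-! ## 2. The admissible mixture density `G(A) = ((a λ⁺(A))^q + (b|A|)^q)^{1/q}` on `ℝ^{3×3}` -/

/-- The mixture density `G_{q,a,b}(A) = ((a λ⁺(A))^q + (b |A|)^q)^{1/q}`. [ours] -/
noncomputable def mixDensity (q a b : ℝ) (A : EuclideanSpace ℝ (Fin 3 × Fin 3)) : ℝ :=
  qMean q (a * max (lam A) 0) (b * ‖A‖)

/-- `mixDensity q a b A ≥ 0` for `a, b ≥ 0`. [ours, bookkeeping; docstring added at filing] -/
theorem mixDensity_nonneg (q : ℝ) {a b : ℝ} (ha : 0 ≤ a) (hb : 0 ≤ b)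
    (A : EuclideanSpace ℝ (Fin 3 × Fin 3)) : 0 ≤ mixDensity q a b A :=
  qMean_nonneg q (mul_nonneg ha (le_max_right _ _)) (mul_nonneg hb (norm_nonneg _))

/-- `G^q = a^q (λ⁺)^q + b^q |A|^q`. [ours] -/
theorem mixDensity_rpow {q : ℝ} (hq : 0 < q) {a b : ℝ} (ha : 0 ≤ a) (hb : 0 ≤ b)
    (A : EuclideanSpace ℝ (Fin 3 × Fin 3)) :
    mixDensity q a b A ^ q = a ^ q * max (lam A) 0 ^ q + b ^ q * ‖A‖ ^ q := by
  unfold mixDensity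
  rw [qMean_rpow hq (mul_nonneg ha (le_max_right _ _)) (mul_nonneg hb (norm_nonneg _)),
    Real.mul_rpow ha (le_max_right _ _), Real.mul_rpow hb (norm_nonneg _)]

/-- **`G` is convex** (`q ≥ 1`, `a, b ≥ 0`). [ours] -/
theorem convexOn_mixDensity {q : ℝ} (hq : 1 ≤ q) {a b : ℝ} (ha : 0 ≤ a) (hb : 0 ≤ b) :
    ConvexOn ℝ univ (mixDensity q a b) := by
  have hq0 : 0 < q := by linarith
  refine ⟨convex_univ, fun A _ B _ s t hs ht hst => ?_⟩
  have h1A : 0 ≤ a * max (lam A) 0 := mul_nonneg ha (le_max_right _ _)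
  have h1B : 0 ≤ a * max (lam B) 0 := mul_nonneg ha (le_max_right _ _)
  have h2A : 0 ≤ b * ‖A‖ := mul_nonneg hb (norm_nonneg _)
  have h2B : 0 ≤ b * ‖B‖ := mul_nonneg hb (norm_nonneg _)
  have hf1 : a * max (lam (s • A + t • B)) 0 ≤ s * (a * max (lam A) 0) + t * (a * max (lam B) 0) := by
    have hl : lam (s • A + t • B) ≤ s * lam A + t * lam B := by
      have h := convexOn_lam.2 (mem_univ A) (mem_univ B) hs ht hst
      simpa only [smul_eq_mul] using h
    have hm : max (lam (s • A + t • B)) 0 ≤ s * max (lam A) 0 + t * max (lam B) 0 := by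
      refine max_le ?_
        (add_nonneg (mul_nonneg hs (le_max_right _ _)) (mul_nonneg ht (le_max_right _ _)))
      exact hl.trans (add_le_add (mul_le_mul_of_nonneg_left (le_max_left _ _) hs)
        (mul_le_mul_of_nonneg_left (le_max_left _ _) ht))
    calc a * max (lam (s • A + t • B)) 0 ≤ a * (s * max (lam A) 0 + t * max (lam B) 0) :=
          mul_le_mul_of_nonneg_left hm ha
      _ = s * (a * max (lam A) 0) + t * (a * max (lam B) 0) := by ring
  have hf2 : b * ‖s • A + t • B‖ ≤ s * (b * ‖A‖) + t * (b * ‖B‖) := by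
    have h := norm_add_le (s • A) (t • B)
    rw [norm_smul, norm_smul, Real.norm_of_nonneg hs, Real.norm_of_nonneg ht] at h
    calc b * ‖s • A + t • B‖ ≤ b * (s * ‖A‖ + t * ‖B‖) := mul_le_mul_of_nonneg_left h hb
      _ = s * (b * ‖A‖) + t * (b * ‖B‖) := by ring
  calc mixDensity q a b (s • A + t • B)
      ≤ qMean q (s * (a * max (lam A) 0) + t * (a * max (lam B) 0))
          (s * (b * ‖A‖) + t * (b * ‖B‖)) :=
        qMean_mono hq0 (mul_nonneg ha (le_max_right _ _)) hf1 (mul_nonneg hb (norm_nonneg _)) hf2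
    _ ≤ qMean q (s * (a * max (lam A) 0)) (s * (b * ‖A‖)) +
          qMean q (t * (a * max (lam B) 0)) (t * (b * ‖B‖)) :=
        qMean_add_le hq (mul_nonneg hs h1A) (mul_nonneg hs h2A) (mul_nonneg ht h1B)
          (mul_nonneg ht h2B)
    _ = s • mixDensity q a b A + t • mixDensity q a b B := by
        rw [qMean_mul hq0 hs h1A h2A, qMean_mul hq0 ht h1B h2B, smul_eq_mul, smul_eq_mul]
        rfl

/-- **`G` is `1`-Lipschitz** when `a^q + b^q = 1` (`q ≥ 1`, `a, b ≥ 0`). [ours] -/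
theorem lipschitzWith_mixDensity {q : ℝ} (hq : 1 ≤ q) {a b : ℝ} (ha : 0 ≤ a) (hb : 0 ≤ b)
    (hab : a ^ q + b ^ q = 1) : LipschitzWith 1 (mixDensity q a b) := by
  have hq0 : 0 < q := by linarith
  have hN1 : qMean q a b = 1 := by unfold qMean; rw [hab, Real.one_rpow]
  refine LipschitzWith.of_le_add fun A B => ?_
  rw [dist_eq_norm]
  have hlam : lam A ≤ lam B + ‖A - B‖ := by
    have h := lipschitzWith_lam.dist_le_mul A B
    rw [NNReal.coe_one, one_mul, Real.dist_eq, dist_eq_norm] at h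
    linarith [le_abs_self (lam A - lam B)]
  have hAB : ‖A‖ ≤ ‖B‖ + ‖A - B‖ := by
    calc ‖A‖ = ‖B + (A - B)‖ := by rw [add_sub_cancel]
      _ ≤ ‖B‖ + ‖A - B‖ := norm_add_le _ _
  have hf1 : a * max (lam A) 0 ≤ a * max (lam B) 0 + a * ‖A - B‖ := by
    have h : max (lam A) 0 ≤ max (lam B) 0 + ‖A - B‖ :=
      max_le (hlam.trans (add_le_add (le_max_left _ _) le_rfl))
        (add_nonneg (le_max_right _ _) (norm_nonneg _))
    calc a * max (lam A) 0 ≤ a * (max (lam B) 0 + ‖A - B‖) := mul_le_mul_of_nonneg_left h ha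
      _ = a * max (lam B) 0 + a * ‖A - B‖ := by ring
  have hf2 : b * ‖A‖ ≤ b * ‖B‖ + b * ‖A - B‖ := by
    calc b * ‖A‖ ≤ b * (‖B‖ + ‖A - B‖) := mul_le_mul_of_nonneg_left hAB hb
      _ = b * ‖B‖ + b * ‖A - B‖ := by ring
  calc mixDensity q a b A
      ≤ qMean q (a * max (lam B) 0 + a * ‖A - B‖) (b * ‖B‖ + b * ‖A - B‖) :=
        qMean_mono hq0 (mul_nonneg ha (le_max_right _ _)) hf1 (mul_nonneg hb (norm_nonneg _)) hf2
    _ ≤ qMean q (a * max (lam B) 0) (b * ‖B‖) + qMean q (a * ‖A - B‖) (b * ‖A - B‖) :=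
        qMean_add_le hq (mul_nonneg ha (le_max_right _ _)) (mul_nonneg hb (norm_nonneg _))
          (mul_nonneg ha (norm_nonneg _)) (mul_nonneg hb (norm_nonneg _))
    _ = mixDensity q a b B + ‖A - B‖ := by
        rw [mul_comm a ‖A - B‖, mul_comm b ‖A - B‖, qMean_mul hq0 (norm_nonneg _) ha hb, hN1,
          mul_one]
        rfl

/-- `G(A) ≤ |A|` when `a^q + b^q = 1` (`λ⁺ ≤ |A|`). [ours] -/
theorem mixDensity_le_norm {q : ℝ} (hq : 0 < q) {a b : ℝ} (ha : 0 ≤ a) (hb : 0 ≤ b)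
    (hab : a ^ q + b ^ q = 1) (A : EuclideanSpace ℝ (Fin 3 × Fin 3)) :
    mixDensity q a b A ≤ ‖A‖ := by
  have hm : max (lam A) 0 ≤ ‖A‖ := max_le (lam_le_norm A) (norm_nonneg _)
  have hN1 : qMean q a b = 1 := by unfold qMean; rw [hab, Real.one_rpow]
  calc mixDensity q a b A ≤ qMean q (a * ‖A‖) (b * ‖A‖) :=
        qMean_mono hq (mul_nonneg ha (le_max_right _ _)) (mul_le_mul_of_nonneg_left hm ha)
          (mul_nonneg hb (norm_nonneg _)) le_rfl
    _ = ‖A‖ := by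
        rw [mul_comm a, mul_comm b, qMean_mul hq (norm_nonneg _) ha hb, hN1, mul_one]

/-- `|A| ≤ 6 G(A)` when `a^q + b^q = 1` and `|A| ≤ 6λ(A)` (the divergence-free strain case). [ours] -/
theorem norm_le_six_mul_mixDensity {q : ℝ} (hq : 0 < q) {a b : ℝ} (ha : 0 ≤ a) (hb : 0 ≤ b)
    (hab : a ^ q + b ^ q = 1) {A : EuclideanSpace ℝ (Fin 3 × Fin 3)} (hA : ‖A‖ ≤ 6 * lam A) :
    ‖A‖ ≤ 6 * mixDensity q a b A := by
  have hN1 : qMean q a b = 1 := by unfold qMean; rw [hab, Real.one_rpow]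
  have h6 : 0 ≤ ‖A‖ / 6 := by positivity
  have h1 : a * (‖A‖ / 6) ≤ a * max (lam A) 0 :=
    mul_le_mul_of_nonneg_left ((by linarith : ‖A‖ / 6 ≤ lam A).trans (le_max_left _ _)) ha
  have h2 : b * (‖A‖ / 6) ≤ b * ‖A‖ :=
    mul_le_mul_of_nonneg_left (by linarith [norm_nonneg A]) hb
  have h := qMean_mono hq (mul_nonneg ha h6) h1 (mul_nonneg hb h6) h2
  rw [mul_comm a (‖A‖ / 6), mul_comm b (‖A‖ / 6), qMean_mul hq h6 ha hb, hN1, mul_one] at h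
  have h' : ‖A‖ / 6 ≤ mixDensity q a b A := h
  linarith

/-- **`∫ G(S)^q = a^q Φ_q + b^q Z_q`** on smooth divergence-free fields of `T³`. [ours] -/
theorem integral_mixDensity_rpow {q : ℝ} (hq : 0 < q) {a b : ℝ} (ha : 0 ≤ a) (hb : 0 ≤ b)
    {v : UnitAddTorus (Fin 3) → EuclideanSpace ℝ (Fin 3)} (hv : Torus.IsSmooth v)
    (hdiv : Torus.IsDivFree v) :
    ∫ x, mixDensity q a b (strainFlat v x) ^ q =
      a ^ q * torusTopEigMoment q v + b ^ q * torusStrainMoment q v := by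
  have hpt : ∀ x, mixDensity q a b (strainFlat v x) ^ q =
      a ^ q * lam (strainFlat v x) ^ q + b ^ q * ‖strainFlat v x‖ ^ q := by
    intro x
    rw [mixDensity_rpow hq ha hb, max_eq_left (lam_strainFlat_nonneg hv hdiv x)]
  simp_rw [hpt]
  have hc1 : Continuous fun x => lam (strainFlat v x) ^ q :=
    (lipschitzWith_lam.continuous.comp (continuous_strainFlat hv)).rpow_const fun _ => Or.inr hq.le
  have hc2 : Continuous fun x => ‖strainFlat v x‖ ^ q :=
    (continuous_strainFlat hv).norm.rpow_const fun _ => Or.inr hq.le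
  rw [integral_add (hc1.integrable_unitAddTorus.const_mul _) (hc2.integrable_unitAddTorus.const_mul _),
    integral_const_mul, integral_const_mul, torusTopEigMoment_eq hv hdiv q,
    torusStrainMoment_eq_integral_norm q v]

/-- `Φ_q ≤ Z_q` on smooth divergence-free fields of `T³` (`λ₁ ≤ |S|`). [ours] -/
theorem torusTopEigMoment_le_torusStrainMoment {q : ℝ} (hq : 0 < q)
    {v : UnitAddTorus (Fin 3) → EuclideanSpace ℝ (Fin 3)} (hv : Torus.IsSmooth v)
    (hdiv : Torus.IsDivFree v) : torusTopEigMoment q v ≤ torusStrainMoment q v := by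
  rw [torusTopEigMoment_eq hv hdiv q, torusStrainMoment_eq_integral_norm q v]
  have hc1 : Continuous fun x => lam (strainFlat v x) ^ q :=
    (lipschitzWith_lam.continuous.comp (continuous_strainFlat hv)).rpow_const fun _ => Or.inr hq.le
  have hc2 : Continuous fun x => ‖strainFlat v x‖ ^ q :=
    (continuous_strainFlat hv).norm.rpow_const fun _ => Or.inr hq.le
  exact integral_mono hc1.integrable_unitAddTorus hc2.integrable_unitAddTorus fun x =>
    Real.rpow_le_rpow (lam_strainFlat_nonneg hv hdiv x) (lam_le_norm _) hq.le

end TopEig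

end Summit.NavierStokesRegularity.FunctionalMining
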